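import Summits.Langlands.Langlands.Theorems.IrreducibilityBySelfDualityReciprocityUpToIrreducibilityCorrespondsConj
import Summits.Langlands.Langlands.Theorems.IrreducibilityBySelfDualityIrreducibleOffSectorOfReciprocity
import Literature.NumberTheory.Automorphic.LocalComponentBJUniqueProofs
import Literature.FieldTheory.AlgClosed.PadicAlgClEquivComplex
import Literature.NumberTheory.GaloisRepresentations.WeilDeligneOfGaloisProofs
import Literature.NumberTheory.GaloisRepresentations.WeilDeligneRepFrobSemisimpleProofs
import Literature.NumberTheory.Automorphic.PairLFunctionPolesRepData
import HarnessLib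

/-!
# Route IrreducibilityBySelfDuality — `ReciprocityUpToIrreducibilityR` (stmt-Langlands-17925), line `Sketch`:
# TIGHTNESS `stub_rigid_of_reciprocityUpToIrreducibilityR` (`--supports` file; no definitions)

The crux `R` of the line,
`∀ F, Nonempty (ReciprocityData F) ∧ ∀ Rec n > 0 hcpt, (A′ for Rec) ∧ GaloisToAutomorphic n Rec hcpt`,
quantifies over EVERY pinned reciprocity datum `Rec`.  This file proves that, granted Arthur–Clozel
(2.2)–(2.3) — the Literature named facts `JacquetShalika1981_partialPairL_boundary_repData` and
`JacquetShalika1981_partialPairL_pole_repData`, carried as HYPOTHESES and never asserted —, `R` forces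
RIGIDITY of the pinned local Langlands data on local components of L-algebraic cuspidal representations:
for any two reciprocity data `Rec Rec'` over a number field `K`, every L-algebraic cuspidal `π` of
`GL_n(𝔸_K)` (`n ≥ 1`), every finite place `v` and every local component `π_v` of `π` at `v`,
`(Rec.llc v).recGL n [π_v] = (Rec'.llc v).recGL n [π_v]`.  This is the necessity direction of the
line's decoupling `R ⇐ N ∧ R_aut ∧ E` (tightness of line `Sketch`).

Proof (ideator card `rigidity-inheritance`).
* Pick a rational prime `ℓ'` with `v ∤ ℓ'` (`2` or `3`) and a field isomorphism `ι' : ℚ̄_{ℓ'} ≃ ℂ`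
  (`PadicAlgCl.nonempty_ringEquiv_complex`).
* `R` over `K` for `Rec` gives an `ℓ'`-adic avatar `ρ₁` of `π` with `Corresponds Rec ι' π ρ₁`; it is
  irreducible by the landed isobaric bootstrap
  `IrreducibleOffSector.isIrreducible_of_reciprocityUpToIrreducibility` (conditional exactly on
  AC (2.2)–(2.3)).
* `R` over `K` for `Rec'` gives SOME `ρ₂` with `Corresponds Rec' ι' π ρ₂`; the weak-to-strong upgrade
  `ReciprocityUpToIrreducibility.corresponds_of_exists_corresponds` (Chebotarev + Brauer–Nesbitt:
  `ρ₂` is conjugate to `ρ₁`, and `Corresponds` descends to conjugacy classes) yields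
  `Corresponds Rec' ι' π ρ₁` for the SAME `ρ₁`.
* Compare the two local–global clauses at `v` (`recGL_eq_of_localGlobalCompatibleAtR`): both attach to
  `ρ₁|_{W_v}` a Weil–Deligne representation by the Grothendieck–Deligne recipe — isomorphic by the
  proved independence of choices `IsWeilDeligneOfLadic.isEquivalent_holds` —, hence
  (`frobSemisimpleClass_eq_of_isEquivalent_of_isTransportAlong`: isomorphic complex transports, the
  Frobenius-semisimple class is an isomorphism invariant and is well defined) ONE Frobenius-semisimple
  class, which is both `(Rec.llc v).recGL n [π_v]` and `(Rec'.llc v).recGL n [π_v]` since local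
  components are unique up to isomorphism (`AutomorphicRepData.hasLocalComponentAt_unique_holds`).

Design.  The sister file
`Summits.Langlands.Langlands.Theorems.IrreducibilityBySelfDualityReciprocityUpToIrreducibilityTightnessAbove`
(crux stmt-Langlands-14328) proves the analogous comparison for ONE datum against the crux's datum; it is
NOT importable here (its import closure contains the route's Theses module, not served in the current
farm window), so the Weil–Deligne invariance it uses in two steps is packaged below as the single lemma
`frobSemisimpleClass_eq_of_isEquivalent_of_isTransportAlong` (proof adapted from there), and the choice
of `ℓ'` is made inline.  For the same reason the third hypothesis `R` of the main theorem — the crux decl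
`Summit.Langlands.Langlands.Theses.IrreducibilityBySelfDuality.ReciprocityUpToIrreducibilityR`, named `R`
in the line skeleton and in the registered stub header — is bound in THIS FILE ONLY as a `local notation`
for the crux's VERBATIM body (no declaration is added; the header stays byte-identical to the registered
one and elaborates to the body spelled out).  Standard axioms only; no `sorry`; no definitions.
-/

noncomputable section

set_option linter.dupNamespace false -- project-wide option (lakefile weak.linter.dupNamespace); `Summit.Langlands.Langlands` is the mandated namespace

open scoped MatrixGroups NumberField
open IsDedekindDomain Filter
open Literature.NumberTheory.Automorphic Literature.NumberTheory.GaloisRepresentations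
open Summit.Langlands

namespace Summit.Langlands.Langlands.Theorems.ReciprocityUpToIrreducibilityR

/-! ## 1. One invariance fact on Weil–Deligne representations -/

section WD

variable {F : Type} [Field F] [ValuativeRel F] [TopologicalSpace F] [IsNonarchimedeanLocalField F]
  {n : ℕ}

/-- **Isomorphic `E`-linear Weil–Deligne representations have complex transports with ONE
Frobenius-semisimple class.**  If `r ≅ r'` over `E`, `s, s'` are `r, r'` transported along
`ι : E →+* ℂ`, and `c, c'` are Frobenius-semisimple classes of `s, s'`, then `c = c'`: the matrix of
the isomorphism, mapped by `ι`, intertwines `s` and `s'` (Deligne 1973, §8.4.3); the class is an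
isomorphism invariant (`ReciprocityUpToIrreducibility.hasFrobSemisimpleClass_of_isEquivalent`) and the
Frobenius-semisimplification is unique (`WeilDeligneRep.existsUnique_frobSemisimplification_holds`,
Deligne 1973, §8.6).  The first step is adapted from `isEquivalent_of_isTransportAlong` of the sister
file `…ReciprocityUpToIrreducibilityTightnessAbove` (not importable here).
[cite: DeligneAntwerpII1973, §8.4.3 and §8.6] -/
theorem frobSemisimpleClass_eq_of_isEquivalent_of_isTransportAlong {E : Type*} [Field E] [CharZero E]
    (ι : E →+* ℂ) {r r' : WeilDeligneRep F E (Fin n → E)} {s s' : WeilDeligneRep F ℂ (Fin n → ℂ)}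
    (h : r.IsEquivalent r') (hs : r.IsTransportAlong ι s) (hs' : r'.IsTransportAlong ι s')
    {c c' : Quotient (frobSemisimpleWDSetoid F n)} (hc : s.HasFrobSemisimpleClass c)
    (hc' : s'.HasFrobSemisimpleClass c') : c = c' := by
  -- Step 1: `s ≅ s'` (adapted from `…TightnessAbove.isEquivalent_of_isTransportAlong`)
  have hss' : s.IsEquivalent s' := by
    obtain ⟨eqv⟩ := h
    set e : (Fin n → E) ≃ₗ[E] (Fin n → E) := eqv.toRepEquiv.toLinearEquiv with he
    set M : Matrix (Fin n) (Fin n) E := LinearMap.toMatrix' (e : (Fin n → E) →ₗ[E] (Fin n → E))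
    set M' : Matrix (Fin n) (Fin n) E :=
      LinearMap.toMatrix' (e.symm : (Fin n → E) →ₗ[E] (Fin n → E))
    have hMM' : M * M' = 1 := by
      rw [← LinearMap.toMatrix'_comp, LinearEquiv.comp_symm, LinearMap.toMatrix'_id]
    have hM'M : M' * M = 1 := by
      rw [← LinearMap.toMatrix'_comp, LinearEquiv.symm_comp, LinearMap.toMatrix'_id]
    -- the intertwining relations of `e`, as matrix identities
    have hρ : ∀ w, M * LinearMap.toMatrix' (r.ρ w) = LinearMap.toMatrix' (r'.ρ w) * M := fun w => by
      rw [← LinearMap.toMatrix'_comp, ← LinearMap.toMatrix'_comp]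
      exact congrArg LinearMap.toMatrix' (eqv.toRepEquiv.toIntertwiningMap.isIntertwining' w)
    have hN : M * LinearMap.toMatrix' r.N = LinearMap.toMatrix' r'.N * M := by
      rw [← LinearMap.toMatrix'_comp, ← LinearMap.toMatrix'_comp]
      exact congrArg LinearMap.toMatrix' eqv.comm_N
    -- mapped by `ι`
    have h1 : M'.map ι * M.map ι = 1 := by
      rw [← Matrix.map_mul, hM'M, Matrix.map_one _ ι.map_zero ι.map_one]
    have h2 : M.map ι * M'.map ι = 1 := by
      rw [← Matrix.map_mul, hMM', Matrix.map_one _ ι.map_zero ι.map_one]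
    let e' : (Fin n → ℂ) ≃ₗ[ℂ] (Fin n → ℂ) := Matrix.toLin'OfInv h1 h2
    have he' : (e' : (Fin n → ℂ) →ₗ[ℂ] (Fin n → ℂ)) = Matrix.toLin' (M.map ι) :=
      LinearMap.ext fun _ => rfl
    have hint : ∀ w, (e' : (Fin n → ℂ) →ₗ[ℂ] (Fin n → ℂ)) ∘ₗ s.ρ w =
        s'.ρ w ∘ₗ (e' : (Fin n → ℂ) →ₗ[ℂ] (Fin n → ℂ)) := fun w => by
      refine LinearMap.toMatrix'.injective ?_
      rw [LinearMap.toMatrix'_comp, LinearMap.toMatrix'_comp, he', LinearMap.toMatrix'_toLin',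
        hs.1 w, hs'.1 w, ← Matrix.map_mul, hρ w, Matrix.map_mul]
    have hintN : (e' : (Fin n → ℂ) →ₗ[ℂ] (Fin n → ℂ)) ∘ₗ s.N =
        s'.N ∘ₗ (e' : (Fin n → ℂ) →ₗ[ℂ] (Fin n → ℂ)) := by
      refine LinearMap.toMatrix'.injective ?_
      rw [LinearMap.toMatrix'_comp, LinearMap.toMatrix'_comp, he', LinearMap.toMatrix'_toLin',
        hs.2, hs'.2, ← Matrix.map_mul, hN, Matrix.map_mul]
    exact ⟨{ toRepEquiv := Representation.Equiv.mk e' hint, comm_N := hintN }⟩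
  -- Step 2: move `c` to `s'` along `s ≅ s'`, then uniqueness of the Frobenius-semisimplification
  obtain ⟨t, ht, rfl⟩ := ReciprocityUpToIrreducibility.hasFrobSemisimpleClass_of_isEquivalent hss' hc
  obtain ⟨t', ht', rfl⟩ := hc'
  obtain rfl : t = t' :=
    (WeilDeligneRep.existsUnique_frobSemisimplification_holds (C := ℂ) (V := Fin n → ℂ) s').unique
      ht ht'
  rfl

end WD

/-! ## 2. Two data compatible with one pair agree on the local component -/

section Summit

variable {K : Type} [Field K] [NumberField K] {n : ℕ} {hcpt : isCompact_glFiniteIntegralLevel n K}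

-- proof adapted from `…Theorems.IrreducibilityBySelfDualityReciprocityUpToIrreducibilityTightnessAbove`
-- (`recGL_eq_of_localGlobalCompatibleAt`); `π` typed as a CUSPIDAL datum and read through `π.1`, which
-- avoids re-synthesising the archimedean instances of `AutomorphyDatum.gl n K hcpt`
/-- **Two reciprocity data that are both locally–globally compatible (away from the residue
characteristic `ℓ'` of the coefficients) with ONE pair `(π, ρ₁)` at `v` (`π` cuspidal) agree on the
local component of `π` at `v`.**  Both attach to `ρ₁|_{W_v}` a Weil–Deligne representation by the
Grothendieck–Deligne recipe (isomorphic: independence of choices,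
`IsWeilDeligneOfLadic.isEquivalent_holds`), transport it to `ℂ` and name its Frobenius-semisimple class
(ONE class, `frobSemisimpleClass_eq_of_isEquivalent_of_isTransportAlong`) as `rec_v` of a local
component of `π` at `v` (unique up to isomorphism,
`AutomorphicRepData.hasLocalComponentAt_unique_holds`). [cite: DeligneAntwerpII1973, §8.4.2] -/
theorem recGL_eq_of_localGlobalCompatibleAtR (Rec Rec₀ : ReciprocityData K) {ℓ' : ℕ} [Fact ℓ'.Prime]
    (ι' : PadicAlgCl ℓ' ≃+* ℂ) (π : CuspidalAutomorphicRepData n K hcpt)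
    (ρ₁ : FramedGaloisRep K (PadicAlgCl ℓ') n) {v : HeightOneSpectrum (𝓞 K)}
    (hv : ((ℓ' : ℕ) : 𝓞 K) ∉ v.asIdeal) (h : LocalGlobalCompatibleAt Rec ι' π.1 ρ₁ v)
    (h₀ : LocalGlobalCompatibleAt Rec₀ ι' π.1 ρ₁ v)
    (πv : SmoothIrrep (GL (Fin n) (v.adicCompletion K))) (hπv : π.1.HasLocalComponentAt v πv.ρ) :
    (Rec.llc v).recGL n (IrrClass.mk πv) = (Rec₀.llc v).recGL n (IrrClass.mk πv) := by
  obtain ⟨πv₁, r₁, rℂ₁, hπv₁, hlad₁, -, htr₁, hcls₁⟩ := h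
  obtain ⟨πv₂, r₂, rℂ₂, hπv₂, hlad₂, -, htr₂, hcls₂⟩ := h₀
  have e₁ : IrrClass.mk πv₁ = IrrClass.mk πv :=
    AutomorphicRepData.hasLocalComponentAt_unique_holds π.1 v πv₁ πv hπv₁ hπv
  have e₂ : IrrClass.mk πv₂ = IrrClass.mk πv :=
    AutomorphicRepData.hasLocalComponentAt_unique_holds π.1 v πv₂ πv hπv₂ hπv
  rw [e₁] at hcls₁
  rw [e₂] at hcls₂
  have hr : r₁.IsEquivalent r₂ :=
    IsWeilDeligneOfLadic.isEquivalent_holds _ r₁ r₂ (hlad₁ hv) (hlad₂ hv)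
  exact frobSemisimpleClass_eq_of_isEquivalent_of_isTransportAlong _ hr htr₁ htr₂ hcls₁ hcls₂

end Summit

/-! ## 3. The registered stub -/

set_option quotPrecheck false in
/-- The crux decl `Summit.Langlands.Langlands.Theses.IrreducibilityBySelfDuality.ReciprocityUpToIrreducibilityR`
(item stmt-Langlands-17925), VERBATIM, under the local spelling `R` that the line skeleton and the
registered stub header use for it: the farm olean of the route's Theses module does not yet serve the
decl, and this `--supports` file stays definitions-free.  No declaration is added; the registered header
below elaborates to the crux's body spelled out (all names fully qualified; the binder notation `∀` has
no precheck handler, whence `quotPrecheck false`).  File-local token, declared immediately before its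
only use (scope: the one theorem below); it shadows no library notation in this file. -/
local notation "R" =>
  (∀ (F : Type) [Field F] [NumberField F], Nonempty (Summit.Langlands.ReciprocityData F) ∧
    ∀ (Rec : Summit.Langlands.ReciprocityData F) (n : ℕ), 0 < n →
      ∀ hcpt : Literature.NumberTheory.Automorphic.isCompact_glFiniteIntegralLevel n F,
        (∀ π : Literature.NumberTheory.Automorphic.CuspidalAutomorphicRepData n F hcpt, π.1.IsLAlgebraic →
          ∀ (ℓ : ℕ) [Fact ℓ.Prime] (ι : PadicAlgCl ℓ ≃+* ℂ),
            ∃ ρ : Literature.NumberTheory.GaloisRepresentations.FramedGaloisRep F (PadicAlgCl ℓ) n,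
              Summit.Langlands.IsGeometricFramed Rec ρ ∧ Summit.Langlands.Corresponds Rec ι π.1 ρ) ∧
        Summit.Langlands.GaloisToAutomorphic n Rec hcpt)

/-- **Stub S-T (TIGHTNESS of line `Sketch`): the crux `R` implies rigidity of the pinned local data on
local components of L-algebraic cuspidal `π`, granted Arthur–Clozel (2.2)–(2.3).**  For reciprocity
data `Rec Rec'` over `K`, an L-algebraic cuspidal `π` of `GL_n(𝔸_K)` (`n ≥ 1`), a finite place `v`
and a local component `π_v` of `π` at `v`: read both data at `v` through a prime `ℓ' ∤ v` (`2` or `3`;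
`PadicAlgCl.nonempty_ringEquiv_complex`); take (A′)'s `ℓ'`-adic avatar `ρ₁` of `π` for `Rec` (third
hypothesis `R` = the crux decl
`Summit.Langlands.Langlands.Theses.IrreducibilityBySelfDuality.ReciprocityUpToIrreducibilityR`, verbatim,
via the local spelling above),
irreducible by the isobaric bootstrap `IrreducibleOffSector.isIrreducible_of_reciprocityUpToIrreducibility`
(this is where AC (2.2)–(2.3) enter); upgrade `Rec'`'s correspondence with SOME avatar to the same
`ρ₁` by Chebotarev rigidity (`ReciprocityUpToIrreducibility.corresponds_of_exists_corresponds`); compare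
the two local–global clauses at `v` (`recGL_eq_of_localGlobalCompatibleAtR`).
[cite: DeligneSerreASENS1974, Lemme 3.2] -/
theorem stub_rigid_of_reciprocityUpToIrreducibilityR :
    JacquetShalika1981_partialPairL_boundary_repData → JacquetShalika1981_partialPairL_pole_repData → R →
    ∀ (K : Type) [Field K] [NumberField K] (Rec Rec' : ReciprocityData K) (n : ℕ)
      (hcpt : isCompact_glFiniteIntegralLevel n K), 0 < n →
      ∀ (π : CuspidalAutomorphicRepData n K hcpt), π.1.IsLAlgebraic →
        ∀ (v : HeightOneSpectrum (𝓞 K)) (πv : SmoothIrrep (GL (Fin n) (v.adicCompletion K))),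
          π.1.HasLocalComponentAt v πv.ρ →
            (Rec.llc v).recGL n (IrrClass.mk πv) = (Rec'.llc v).recGL n (IrrClass.mk πv) := by
  intro h22 h23 hR K _ _ Rec Rec' n hcpt hn π hπ v πv hπv
  -- a prime away from `v` (`2` or `3`: else `1 = 3 - 2 ∈ v`); adapted from
  -- `…TightnessAbove.exists_prime_natCast_not_mem`
  obtain ⟨ℓ', _, hℓ'⟩ : ∃ (ℓ' : ℕ) (_ : Fact ℓ'.Prime), ((ℓ' : ℕ) : 𝓞 K) ∉ v.asIdeal := by
    by_cases h2 : ((2 : ℕ) : 𝓞 K) ∈ v.asIdeal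
    · refine ⟨3, ⟨Nat.prime_three⟩, fun h3 => v.isPrime.ne_top ((Ideal.eq_top_iff_one _).2 ?_)⟩
      have h := v.asIdeal.sub_mem h3 h2
      have h1 : ((3 : ℕ) : 𝓞 K) - ((2 : ℕ) : 𝓞 K) = 1 := by push_cast; norm_num
      rwa [h1] at h
    · exact ⟨2, ⟨Nat.prime_two⟩, h2⟩
  -- a field isomorphism `ℚ̄_{ℓ'} ≃ ℂ`
  obtain ⟨ι'⟩ := PadicAlgCl.nonempty_ringEquiv_complex ℓ'
  -- the crux over `K`, for `Rec` and for `Rec'`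
  obtain ⟨-, hK⟩ := hR K
  obtain ⟨ρ₁, -, hcorr₁⟩ := (hK Rec n hn hcpt).1 π hπ ℓ' ι'
  obtain ⟨ρ₂, -, hcorr₂⟩ := (hK Rec' n hn hcpt).1 π hπ ℓ' ι'
  -- `Rec`'s avatar is irreducible (isobaric bootstrap, AC (2.2)–(2.3))
  have hirr₁ : ρ₁.toGaloisRep.IsIrreducible :=
    IrreducibleOffSector.isIrreducible_of_reciprocityUpToIrreducibility h22 h23 (hK Rec) hcpt hn π hπ
      ι' ρ₁ hcorr₁.1
  -- `Rec'` corresponds to the SAME avatar (weak-to-strong upgrade)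
  have hcorr₁' : Corresponds Rec' ι' π.1 ρ₁ :=
    ReciprocityUpToIrreducibility.corresponds_of_exists_corresponds hirr₁ hcorr₁.1 ⟨ρ₂, hcorr₂⟩
  -- compare the two local–global clauses at `v`
  exact recGL_eq_of_localGlobalCompatibleAtR Rec Rec' ι' π ρ₁ hℓ' (hcorr₁.2 v) (hcorr₁'.2 v) πv hπv

end Summit.Langlands.Langlands.Theorems.ReciprocityUpToIrreducibilityR

end
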